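import Summits.QuantumFields.BalabanUV.T4Continuum.Support.BlockAverageCurrent
import Summits.QuantumFields.BalabanUV.T4Continuum.Support.NE3FluxGradientDictionary
import Summits.QuantumFields.BalabanUV.T4Continuum.Support.AveragingDeficitMultiLevelBridge
import HarnessLib

/-!
# NE3 support: THE PLAQUETTE-GRADIENT RADIUS OF THE AVERAGED CONFIGURATION `rescale L (bavg L U)` (`= cavg L U`) —
# regularity transport through one block averaging (42), k-UNIFORMLY

Cell `pub-balaban-gaps` (YM blitz, track G2, seat `ne3`, unit `pub-balaban-gaps-ne3-g8`; writer prover-pub-balaban-gaps-ne3-g8-0, 2026-08-24),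
census `run/shared/lean/pub/pub-balaban-gaps/ne/NE3.md` §4 R39, remaining door «the regularity radii of THE END's backgrounds
`W = cavg L U_B`».  WHY.  The seat's curved sup-regularity files (`Spine/NE3/AxialGaugeDivergence`, `Spine/NE3/SupRegularityCurvedUniform`)
prove the END's (H0_W) ∕ `hK(W)` at every background `W` of the class from two radii of `W`: the plaquette radius `x` (GIVEN in the END's
binder as `SmallField (cavg L U_B) (ε∕M²)`) and the covariant PLAQUETTE-GRADIENT radius `x₁`
(`‖Ad_{W(p,λ)} W(∂p_{μν}(p+e_λ)) − W(∂p_{μν}(p))‖ ≤ x₁`), with `M³x₁` small.  This file supplies `x₁` for `W = rescale L (bavg L U)`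
from sup-regularity data of `U` one level up, exactly as `Support/BlockAverageCurrent` supplies the CURRENT (1.9) of the same `W`
(the current is a signed sum of `d − 1` of the transported differences bounded here):

* §1 `norm_plaqGrad_gaugeAct'` — the transported plaquette difference is gauge COVARIANT (conjugation by `u(p)`), its norm gauge
  invariant (every plane, every transport direction);
* §2 **`norm_plaqGrad_rescale_bavg_le`** — unitary `U`, `SmallField U a`, `512(d+1)(d+4)L²a ≤ 1`, flux gradients `≤ g`,
  `2(d+1)(2dL+8L+8)·a ≤ α`, `(2dL+2L)·α ≤ θ ≤ 1∕64` ⇒ for every bond `(p, λ)` and plane `μ ≠ ν`: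
  `‖Ad_{W̄(p,λ)} W̄(∂p_{μν}(p+e_λ)) − W̄(∂p_{μν}(p))‖ ≤ L³(2g + αa + 2ρ(4α)) + 520θ²`, `W̄ = rescale L (bavg L U)` — the near-identity-gauge
  core `BlockAverageCurrentNearId.norm_transDiff_cplaq_bavg_le` in the axial gauge of `BlockAverageCurrent.exists_nearId_gauge` centred at
  the coarse corner `L·(p + e_λ)`, the flux-Lipschitz datum in BOTH orientations (`NE3FluxGradientDictionary.norm_Ad_hol_sub_hol_le_of_fluxGrad`),
  gauge covariance (45) (`rescale_bavg_gaugeAct`) + §1;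
* §3 **`norm_plaqGrad_rescale_bavg_le_scaled`** — the tree's `∕(L^k)` currency: `SmallField U (b∕(L^{k+1})²)`, flux gradients `≤ c∕(L^{k+1})³`
  (the `small`∕`grad` fields of `MinimalActionRefine.RegularSup d L N b c (k+1) U`), regime (Rb) `2¹⁵(d+1)²(d+4)²L²b ≤ 1` ⇒
  `x₁(W̄) ≤ 2(c + curConst d L·b²)∕(L^k)³` — so `M³x₁ = 2(c + curConst·b²)` with `M = L^k`, LEVEL-FREE; `norm_plaqGrad_cavg_le_of_regularSup` —
  the same for `cavg L U` read from `RegularSup`.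

HONEST: kinematics of (42) for sup-regular configurations ([Balaban1985RegularSpaces] Prop. 3 ∕ [Balaban1985Variational] Thm 1 (10) assert
regularity of this TYPE for minimisers — nothing of that is asserted here); NE3 NOT proved; spine 0∕9; NOT continuum ∕ Clay.
-/

set_option autoImplicit false

open scoped BigOperators Matrix Matrix.Norms.L2Operator
open NormedSpace Finset

namespace Summit.QuantumFields.BalabanUV.T4Continuum.NE3AveragedGradientRadius

open Literature.MathematicalPhysics.QuantumFieldTheory.Balaban1983to89
open B7Prop1Explicit B7Prop2Explicit B7Prop1Local MatrixLog UnitaryModel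
open B7Eq78Linearization (conjR conjR_apply)
open B8Ineq132 (plaqF)
open T4AveragingDeficitWall (Ad IsUnitaryCfg SmallField covGrad flux Plane)
open T4AveragingDeficitNonAbelian (Ad_mul Ad_sub)
open AveragingDeficitTransport (norm_Ad_of_unitary mem_U1_of_unitary)
open AveragingDeficitKDatum (isUnitaryCfg_gaugeAct norm_covGrad_flux_eq_of_gaugeAct)
open AveragingDeficitChartCalculus (cavg)
open AveragingDeficitMultiLevelBridge (cavg_eq_rescale_bavg)
open GaugeFieldPerturbation (norm_fhol_sub_one_le_of_smallField)
open MinimalActionRefine (RegularSup)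
open MinimalActionLevels (isUnitaryCfg_rescale_bavg)
open BlockAverageLoopLogCore (hol_plaqWord_gaugeAct)
open BlockAverageCurrentNearId (norm_transDiff_cplaq_bavg_le)
open BlockAverageCurrent (smallField_gaugeAct rescale_bavg_gaugeAct exists_nearId_gauge gaugeConst curConst curConst_nonneg
  gaugeConst_nonneg regime_of_Rb scaled_arith)
open NE3FluxGradientDictionary (norm_Ad_hol_sub_hol_le_of_fluxGrad)

noncomputable section

variable {d : ℕ} {n : Type*} [Fintype n] [DecidableEq n] [Nonempty n]

/-! ## §1 Gauge covariance of the transported plaquette difference -/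

omit [Nonempty n] in
/-- The transported plaquette difference `Ad_{W(p,λ)} W(∂p_{μν}(p+e_λ)) − W(∂p_{μν}(p))` is conjugated by `u(p)` under a gauge transformation
`W ↦ W^u`; for unitary `u` its norm is gauge invariant (every plane, every direction). [folklore] -/
theorem norm_plaqGrad_gaugeAct' {W : Site d → Fin d → (Matrix n n ℂ)ˣ} {u : Site d → (Matrix n n ℂ)ˣ}
    (hu : ∀ z, u z ∈ unitaryUnits (Matrix n n ℂ)) (p : Site d) (lam μ ν : Fin d) :
    ‖Ad (gaugeAct u W p lam) ((hol (gaugeAct u W) (p + e lam) (plaqWord μ ν) : (Matrix n n ℂ)ˣ) : Matrix n n ℂ)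
        - ((hol (gaugeAct u W) p (plaqWord μ ν) : (Matrix n n ℂ)ˣ) : Matrix n n ℂ)‖
      = ‖Ad (W p lam) ((hol W (p + e lam) (plaqWord μ ν) : (Matrix n n ℂ)ˣ) : Matrix n n ℂ) - ((hol W p (plaqWord μ ν) : (Matrix n n ℂ)ˣ) : Matrix n n ℂ)‖ := by
  have hAdU : ∀ (A Y : (Matrix n n ℂ)ˣ), Ad A (Y : Matrix n n ℂ) = ((A * Y * A⁻¹ : (Matrix n n ℂ)ˣ) : Matrix n n ℂ) := fun A Y => by
    simp [Ad]
  -- the units identity behind the covariance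
  have key : gaugeAct u W p lam * hol (gaugeAct u W) (p + e lam) (plaqWord μ ν) * (gaugeAct u W p lam)⁻¹
      = u p * (W p lam * hol W (p + e lam) (plaqWord μ ν) * (W p lam)⁻¹) * (u p)⁻¹ := by
    rw [hol_plaqWord_gaugeAct, show gaugeAct u W p lam = u p * W p lam * (u (p + e lam))⁻¹ from rfl]
    group
  have h1 : Ad (gaugeAct u W p lam) ((hol (gaugeAct u W) (p + e lam) (plaqWord μ ν) : (Matrix n n ℂ)ˣ) : Matrix n n ℂ)
      - ((hol (gaugeAct u W) p (plaqWord μ ν) : (Matrix n n ℂ)ˣ) : Matrix n n ℂ)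
      = Ad (u p) (Ad (W p lam) ((hol W (p + e lam) (plaqWord μ ν) : (Matrix n n ℂ)ˣ) : Matrix n n ℂ) - ((hol W p (plaqWord μ ν) : (Matrix n n ℂ)ˣ) : Matrix n n ℂ)) := by
    rw [hAdU, key, hol_plaqWord_gaugeAct, Ad_sub, hAdU, hAdU, hAdU]
  rw [h1, norm_Ad_of_unitary (hu p)]

/-! ## §2 The plaquette-gradient radius of `rescale L (bavg L U)` -/

/-- **THE PLAQUETTE-GRADIENT RADIUS OF THE AVERAGED CONFIGURATION, UNSCALED.**  Unitary `U` with `SmallField U a`, `512(d+1)(d+4)L²a ≤ 1`,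
covariant flux gradients `‖(∇_U F)(y,κ;π)‖ ≤ g` at every bond and ordered plane, and `2(d+1)(2dL+8L+8)·a ≤ α`, `(2dL+2L)·α ≤ θ ≤ 1∕64` ⇒ for
every bond `(p, λ)` and every plane `μ ≠ ν`: `‖Ad_{W̄(p,λ)} W̄(∂p_{μν}(p+e_λ)) − W̄(∂p_{μν}(p))‖ ≤ L³(2g + α·a + 2ρ(4α)) + 520θ²`, `W̄ = rescale L (bavg L U)`,
`ρ(t) = e^t − 1 − t`. [folklore] -/
theorem norm_plaqGrad_rescale_bavg_le {L : ℕ} (hL : 1 ≤ L) {U : Site d → Fin d → (Matrix n n ℂ)ˣ} (hU : IsUnitaryCfg U)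
    {a g α θ : ℝ} (ha : 0 ≤ a) (hsmall : 512 * (d + 1) * (d + 4) * (L : ℝ) ^ 2 * a ≤ 1)
    (hα : 2 * (((d + 1) * (2 * (d * L) + 8 * L + 8) : ℕ) : ℝ) * a ≤ α)
    (hθ : ((2 * (d * L) + L + L : ℕ) : ℝ) * α ≤ θ) (hθ1 : θ ≤ 1 / 64) (hS : SmallField U a)
    (hG : ∀ (y : Site d) (κ : Fin d) (π : Plane d), ‖covGrad U (flux U) y κ π‖ ≤ g)
    (p : Site d) (lam : Fin d) {μ ν : Fin d} (hμν : μ ≠ ν) :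
    ‖Ad (rescale L (bavg L U) p lam) ((hol (rescale L (bavg L U)) (p + e lam) (plaqWord μ ν) : (Matrix n n ℂ)ˣ) : Matrix n n ℂ)
        - ((hol (rescale L (bavg L U)) p (plaqWord μ ν) : (Matrix n n ℂ)ˣ) : Matrix n n ℂ)‖
      ≤ (L : ℝ) ^ 3 * (2 * g + α * a + 2 * expRem (4 * α)) + 520 * θ ^ 2 := by
  have hL1 : (1 : ℝ) ≤ L := by exact_mod_cast hL
  have hK : (4 : ℝ) ≤ 512 * (d + 1) * (d + 4) * (L : ℝ) ^ 2 := by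
    have hd0 : (0 : ℝ) ≤ d := Nat.cast_nonneg d
    have hL2 : (1 : ℝ) ≤ (L : ℝ) ^ 2 := one_le_pow₀ hL1
    calc (4 : ℝ) ≤ 512 * 1 * 4 * 1 := by norm_num
      _ ≤ 512 * ((d : ℝ) + 1) * ((d : ℝ) + 4) * (L : ℝ) ^ 2 := by gcongr <;> linarith
  have ha4 : a ≤ 1 / 4 := by nlinarith
  have hα0 : 0 ≤ α := le_trans (by positivity) hα
  -- the gauge around the coarse corner `L·(p + e_λ)`
  set x : Site d := p + e lam with hxdef
  obtain ⟨u, hu, hbond⟩ := exists_nearId_gauge hU ha hS ((L : ℤ) • x) (2 * (d * L) + 8 * L + 8)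
  have hu1 : ∀ z, u z ∈ U1 (Matrix n n ℂ) := fun z => mem_U1_of_unitary (hu z)
  have hV₀ : IsUnitaryCfg (gaugeAct u U) := isUnitaryCfg_gaugeAct hu hU
  have hS0 : SmallField (gaugeAct u U) a := smallField_gaugeAct hu hS
  have hb : ∀ (y : Site d) (κ : Fin d), l1 (y - (L : ℤ) • x) ≤ 2 * (d * L) + 8 * L + 8 →
      ‖((gaugeAct u U y κ : (Matrix n n ℂ)ˣ) : (Matrix n n ℂ)) - 1‖ ≤ α / 2 := fun y κ hy =>
    (hbond y κ hy).trans (by linarith)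
  -- the flux-Lipschitz datum in gauge-invariant form, BOTH orientations
  have hG0 : ∀ (y : Site d) (κ : Fin d) (π : Plane d), ‖covGrad (gaugeAct u U) (flux (gaugeAct u U)) y κ π‖ ≤ g := by
    intro y κ π
    rw [← norm_covGrad_flux_eq_of_gaugeAct hu U y κ π
      ((norm_fhol_sub_one_le_of_smallField hS0 _).trans_lt (by linarith))
      ((norm_fhol_sub_one_le_of_smallField hS0 _).trans_lt (by linarith))]
    exact hG y κ π
  have hΔ : ∀ (y : Site d) (lam' : Fin d),
      ‖Ad (gaugeAct u U y lam') ((hol (gaugeAct u U) (y + e lam') (plaqWord μ ν) : (Matrix n n ℂ)ˣ) : (Matrix n n ℂ))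
          - ((hol (gaugeAct u U) y (plaqWord μ ν) : (Matrix n n ℂ)ˣ) : (Matrix n n ℂ))‖ ≤ 2 * g := fun y lam' =>
    norm_Ad_hol_sub_hol_le_of_fluxGrad hV₀ hS0 ha4 hG0 y lam' hμν
  -- file 1 at the coarse corner, backward form at `x = p + e_λ`
  have hF1 := norm_transDiff_cplaq_bavg_le hL hV₀ ((L : ℤ) • x) hα0 hθ hθ1 hb (fun y => hS0 y μ ν hμν) hΔ x rfl lam
  have hxp : x - e lam = p := by rw [hxdef, add_sub_cancel_right]
  rw [hxp] at hF1
  -- the averaged gauge-transformed configuration is the gauge transform of the averaged one, (45)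
  set W : Site d → Fin d → (Matrix n n ℂ)ˣ := rescale L (bavg L U) with hWdef
  have hWg : rescale L (bavg L (gaugeAct u U)) = gaugeAct (fun z => u ((L : ℤ) • z)) W := rescale_bavg_gaugeAct hL hU ha hsmall hS hu1
  rw [hWg] at hF1
  set Wg : Site d → Fin d → (Matrix n n ℂ)ˣ := gaugeAct (fun z => u ((L : ℤ) • z)) W with hWgdef
  have hug : ∀ z, (fun z => u ((L : ℤ) • z)) z ∈ unitaryUnits (Matrix n n ℂ) := fun z => hu _
  have hWu : IsUnitaryCfg W := isUnitaryCfg_rescale_bavg L hL hU ha hsmall hS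
  have hWgu : IsUnitaryCfg Wg := isUnitaryCfg_gaugeAct hug hWu
  -- backward form ⟶ forward form (transport by the unitary `Wg(p, λ)`)
  have hfwd : ‖Ad (Wg p lam) ((hol Wg (p + e lam) (plaqWord μ ν) : (Matrix n n ℂ)ˣ) : Matrix n n ℂ)
        - ((hol Wg p (plaqWord μ ν) : (Matrix n n ℂ)ˣ) : Matrix n n ℂ)‖
      = ‖conjR (Wg p lam)⁻¹ (plaqF Wg μ ν p) - plaqF Wg μ ν (p + e lam)‖ := by
    have e1 : conjR (Wg p lam)⁻¹ (plaqF Wg μ ν p) - plaqF Wg μ ν (p + e lam)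
        = Ad (Wg p lam)⁻¹ (((hol Wg p (plaqWord μ ν) : (Matrix n n ℂ)ˣ) : Matrix n n ℂ)
            - Ad (Wg p lam) ((hol Wg (p + e lam) (plaqWord μ ν) : (Matrix n n ℂ)ˣ) : Matrix n n ℂ)) := by
      rw [Ad_sub, ← Ad_mul, inv_mul_cancel]
      simp [Ad, conjR_apply, plaqF]
    rw [e1, norm_Ad_of_unitary ((unitaryUnits _).inv_mem (hWgu p lam)), norm_sub_rev]
  rw [← norm_plaqGrad_gaugeAct' (W := W) hug p lam μ ν, hfwd]
  exact hF1

/-! ## §3 The `∕(L^k)` currency -/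

/-- **THE PLAQUETTE-GRADIENT RADIUS OF THE AVERAGED CONFIGURATION IN THE TREE's `∕(L^k)` CURRENCY.**  `L ≥ 1`; unitary `U` with
`SmallField U (b∕(L^{k+1})²)` and covariant flux gradients `≤ c∕(L^{k+1})³` (the `small`∕`grad` fields of `RegularSup d L N b c (k+1) U`); regime (Rb)
`2¹⁵(d+1)²(d+4)²L²·b ≤ 1` ⇒ for every bond `(p, λ)` and plane `μ ≠ ν`:
`‖Ad_{W̄(p,λ)} W̄(∂p_{μν}(p+e_λ)) − W̄(∂p_{μν}(p))‖ ≤ 2(c + curConst d L·b²)∕(L^k)³`, `W̄ = rescale L (bavg L U)` — LEVEL-FREE after multiplication by `M³ = (L^k)³`.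
[folklore] -/
theorem norm_plaqGrad_rescale_bavg_le_scaled {L : ℕ} (hL : 1 ≤ L) {U : Site d → Fin d → (Matrix n n ℂ)ˣ}
    (hU : IsUnitaryCfg U) {b c : ℝ} {k : ℕ} (hb : 0 ≤ b)
    (hRb : 2 ^ 15 * ((d : ℝ) + 1) ^ 2 * ((d : ℝ) + 4) ^ 2 * (L : ℝ) ^ 2 * b ≤ 1)
    (hS : SmallField U (b / ((L : ℝ) ^ (k + 1)) ^ 2))
    (hG : ∀ (y : Site d) (κ : Fin d) (π : Plane d), ‖covGrad U (flux U) y κ π‖ ≤ c / ((L : ℝ) ^ (k + 1)) ^ 3)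
    (p : Site d) (lam : Fin d) {μ ν : Fin d} (hμν : μ ≠ ν) :
    ‖Ad (rescale L (bavg L U) p lam) ((hol (rescale L (bavg L U)) (p + e lam) (plaqWord μ ν) : (Matrix n n ℂ)ˣ) : Matrix n n ℂ)
        - ((hol (rescale L (bavg L U)) p (plaqWord μ ν) : (Matrix n n ℂ)ˣ) : Matrix n n ℂ)‖
      ≤ 2 * (c + curConst d L * b ^ 2) / ((L : ℝ) ^ k) ^ 3 := by
  have hL1 : (1 : ℝ) ≤ L := by exact_mod_cast hL
  have hLk : (1 : ℝ) ≤ (L : ℝ) ^ k := one_le_pow₀ hL1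
  have hLk0 : (0 : ℝ) < (L : ℝ) ^ k := by linarith
  have hs : (L : ℝ) ^ (k + 1) = (L : ℝ) ^ k * L := pow_succ _ _
  have ha0 : 0 ≤ b / ((L : ℝ) ^ (k + 1)) ^ 2 := div_nonneg hb (by positivity)
  obtain ⟨hsmall, hθ1⟩ := regime_of_Rb (d := d) hL hb hRb k
  have hA : 2 * (((d + 1) * (2 * (d * L) + 8 * L + 8) : ℕ) : ℝ) * (b / ((L : ℝ) ^ (k + 1)) ^ 2)
      ≤ gaugeConst d L * (b / ((L : ℝ) ^ (k + 1)) ^ 2) := le_of_eq (by rw [gaugeConst])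
  have h := norm_plaqGrad_rescale_bavg_le hL hU ha0 hsmall hA le_rfl hθ1 hS hG p lam hμν
  have hB : (4 : ℝ) ≤ ((2 * (d * L) + L + L : ℕ) : ℝ) := by
    have hd : 1 ≤ d := μ.pos
    have : 4 ≤ 2 * (d * L) + L + L := by nlinarith
    exact_mod_cast this
  have key := scaled_arith (c := c) (dm1 := 1) hLk hL1 hb (gaugeConst_nonneg (d := d) L) hB zero_le_one (by rw [hs] at hθ1; exact hθ1)
  rw [hs] at h
  refine h.trans ?_
  -- `key : t * (1 * X) ≤ 2 * 1 * (c + K b²) / t²`, `t = L^k`; divide by `t`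
  set X : ℝ := (L : ℝ) ^ 3 * (2 * (c / ((L : ℝ) ^ k * L) ^ 3) + gaugeConst d L * (b / ((L : ℝ) ^ k * L) ^ 2) * (b / ((L : ℝ) ^ k * L) ^ 2)
          + 2 * expRem (4 * (gaugeConst d L * (b / ((L : ℝ) ^ k * L) ^ 2))))
        + 520 * (((2 * (d * L) + L + L : ℕ) : ℝ) * (gaugeConst d L * (b / ((L : ℝ) ^ k * L) ^ 2))) ^ 2 with hXdef
  rw [one_mul, mul_one] at key
  have key' := (le_div_iff₀ (by positivity : (0 : ℝ) < ((L : ℝ) ^ k) ^ 2)).mp key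
  unfold curConst
  rw [le_div_iff₀ (by positivity)]
  calc X * ((L : ℝ) ^ k) ^ 3 = (L : ℝ) ^ k * X * ((L : ℝ) ^ k) ^ 2 := by ring
    _ ≤ 2 * (c + (gaugeConst d L + 32 * gaugeConst d L ^ 2 + 520 * (((2 * (d * L) + L + L : ℕ) : ℝ) * gaugeConst d L) ^ 2) / 2 * b ^ 2) := key'

/-- **THE PLAQUETTE-GRADIENT RADIUS OF `cavg L U` FROM `RegularSup`** (`cavg L U = rescale L (bavg L U)`, `rfl`): `RegularSup d L N b c (k+1) U` and (Rb) give
`‖Ad_{W(p,λ)} W(∂p_{μν}(p+e_λ)) − W(∂p_{μν}(p))‖ ≤ 2(c + curConst d L·b²)∕(L^k)³` for `W = cavg L U`, every bond and plane `μ ≠ ν`. [folklore] -/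
theorem norm_plaqGrad_cavg_le_of_regularSup {L N : ℕ} (hL : 1 ≤ L) {U : Site d → Fin d → (Matrix n n ℂ)ˣ} {b c : ℝ} {k : ℕ}
    (hreg : RegularSup d L N b c (k + 1) U) (hb : 0 ≤ b)
    (hRb : 2 ^ 15 * ((d : ℝ) + 1) ^ 2 * ((d : ℝ) + 4) ^ 2 * (L : ℝ) ^ 2 * b ≤ 1)
    (p : Site d) (lam : Fin d) {μ ν : Fin d} (hμν : μ ≠ ν) :
    ‖Ad (cavg L U p lam) ((hol (cavg L U) (p + e lam) (plaqWord μ ν) : (Matrix n n ℂ)ˣ) : Matrix n n ℂ)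
        - ((hol (cavg L U) p (plaqWord μ ν) : (Matrix n n ℂ)ˣ) : Matrix n n ℂ)‖
      ≤ 2 * (c + curConst d L * b ^ 2) / ((L : ℝ) ^ k) ^ 3 := by
  rw [cavg_eq_rescale_bavg]
  exact norm_plaqGrad_rescale_bavg_le_scaled hL hreg.unitary hb hRb hreg.small hreg.grad p lam hμν

end

end Summit.QuantumFields.BalabanUV.T4Continuum.NE3AveragedGradientRadius
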